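import Literature.Analysis.FluidPDE.KatoSmallDataForcedClassical
import Literature.Analysis.FluidPDE.ClassicalShortTimeSupBound
import HarnessLib

/-!
# Small `L³` data: a classical free run on every slab that never exceeds twice the initial
# maximum speed (Kato 1984, Thm. 2–4 + Leray 1934, §19/§21)

Analysis/FluidPDE proof file (theorems only; no definition, no named fact). A folklore combination of
two theorems of the tree, for the unforced incompressible Navier–Stokes system on `ℝ³` at viscosity
`ν > 0`:

* **Kato's small-data theory** in the weighted class `t^{1/4}L⁶ ∩ t^{1/2}L^∞`, classical output
  (`KatoSmallDataForced.exists_classical_fullSlab`, `KatoSmallDataForced.norm_le_of_taoClass`, run on the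
  a-priori estimate `KatoAprioriForced.kato_apriori_forced`; Kato 1984, Thm. 2–4; Lemarié-Rieusset 2016,
  Thm. 15.2 with Thm. 7.2/7.3): if `‖u₀‖_{L³} ≤ ε₀ ν` the free run from `u₀` exists classically on every
  slab `[0, T]` and obeys `|u(t, x)| ≤ K (‖u₀‖₃/ν) ν^{1/2} t^{-1/2}`;
* **Leray's short-time bound** (`exists_norm_le_two_mul_of_finiteEnergy`; Leray 1934, §19 (3.8) and
  §21 (3.15); Ożański–Pooley 2018, Lemma 6.23 (i)): a finite-energy classical free run with
  `|u(0, ·)| ≤ A` obeys `|u(t, ·)| ≤ 2A` for `t < c₀ ν / A²`.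

Together: **there is a universal `c > 0` such that every smooth compactly supported divergence-free
datum `u₀` with `|u₀| ≤ A` and `‖u₀‖_{L³} ≤ c ν` generates, on EVERY slab `[0, T]`, a classical
finite-energy free run in Tao's class with `|u(t, x)| ≤ 2A` for all `t ∈ [0, T]` and all `x`**
(`exists_classical_run_norm_le_two_mul`): for `t < c₀ν/A²` this is Leray's bound, and for
`t ≥ c₀ν/A²` Kato's decay gives `|u| ≤ K c ν^{1/2} (c₀ν/A²)^{-1/2} = K c A/√c₀ ≤ A` once `c ≤ √c₀/K`.
`exists_classical_run_norm_le_two_mul_Icc` is the same on a slab `[t₀, t₁]` (time shift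
`IsClassicalNSSolutionOn.comp_add_right`).

WHAT THIS IS NOT: not a statement about large data — a small-data (scale-invariantly small `L³` norm)
existence-with-sup-bound theorem for GIVEN data; the constant `c` is inexplicit (Kato's `ε₀`, `K` and
Leray's `c₀` are existential in the tree).

## Mathlib / tree search

`lean search 'norm_le_two_mul|smallData|kato_apriori'`: the two inputs above and
`exists_norm_le_two_mul_of_window` (bounded-on-the-strip hypothesis); no sup-bounded global form existed.

## References

* T. Kato, *Strong `L^p`-solutions of the Navier–Stokes equation in `ℝ^m`, with applications to weak
  solutions*, Math. Z. 187 (1984) 471–480, Thm. 2–4. [Kato1984]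
* J. Leray, *Sur le mouvement d'un liquide visqueux emplissant l'espace*, Acta Math. 63 (1934)
  193–248, §19 (3.8), §21 (3.14)–(3.15). [Leray1934]
* P. G. Lemarié-Rieusset, *The Navier–Stokes Problem in the 21st Century*, CRC Press (2016),
  Thm. 15.2, Thm. 7.2–7.3. [LemarieRieusset2016]
* W. S. Ożański, B. C. Pooley, *Leray's fundamental work on the Navier–Stokes equations*, LMS Lecture
  Note Ser. 452 (2018), Lemma 6.23 (i). [OzanskiPooley2018]
-/

noncomputable section

open MeasureTheory TopologicalSpace Set Function Filter
open _root_.Topology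
open scoped ENNReal NNReal ContDiff

namespace Literature.Analysis.FluidPDE

namespace SmallL3ClassicalSupBound

/-! ### Tools -/

/-- The zero force is smooth on the closed half-space. [folklore] -/
private theorem isSmoothOnHalfSpace_zero :
    IsSmoothOnHalfSpace (0 : ℝ → EuclideanSpace ℝ (Fin 3) → EuclideanSpace ℝ (Fin 3)) := by
  have h : uncurry (0 : ℝ → EuclideanSpace ℝ (Fin 3) → EuclideanSpace ℝ (Fin 3)) = fun _ => 0 := by
    funext q; rfl
  rw [IsSmoothOnHalfSpace, h]
  exact contDiffOn_const

/-- The zero force has Fefferman's space-time decay. [folklore] -/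
private theorem hasRapidSpaceTimeDecay_zero :
    HasRapidSpaceTimeDecay (0 : ℝ → EuclideanSpace ℝ (Fin 3) → EuclideanSpace ℝ (Fin 3)) := by
  intro n K
  have h : uncurry (0 : ℝ → EuclideanSpace ℝ (Fin 3) → EuclideanSpace ℝ (Fin 3)) = 0 := by
    funext q; rfl
  refine ⟨0, fun t _ x => ?_⟩
  rw [h, iteratedFDerivWithin_zero]
  simp

/-- The zero force has `L²` slices of size `≤ 0`. [folklore] -/
private theorem eLpNorm_zero_slice_le (t : ℝ) :
    eLpNorm ((0 : ℝ → EuclideanSpace ℝ (Fin 3) → EuclideanSpace ℝ (Fin 3)) t) 2 volume ≤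
      ENNReal.ofReal 0 := by
  have h : (0 : ℝ → EuclideanSpace ℝ (Fin 3) → EuclideanSpace ℝ (Fin 3)) t = 0 := rfl
  rw [h, eLpNorm_zero]
  exact bot_le

/-- `∫ ‖D⁰g‖² = ∫ ‖g‖²`. [folklore] -/
private theorem lintegral_iteratedFDeriv_zero_eq (g : EuclideanSpace ℝ (Fin 3) → EuclideanSpace ℝ (Fin 3)) :
    ∫⁻ x, ‖iteratedFDeriv ℝ 0 g x‖ₑ ^ 2 = ∫⁻ x, ‖g x‖ₑ ^ 2 :=
  lintegral_congr fun x => by rw [← ofReal_norm, norm_iteratedFDeriv_zero, ofReal_norm]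

/-- `ν^{1/2} t^{-1/2} ≤ A/√c₀` once `c₀ ν / A² ≤ t` (`ν, c₀, A, t > 0`). [folklore] -/
private theorem rpow_half_mul_rpow_neg_half_le {ν c₀ A t : ℝ} (hν : 0 < ν) (hc₀ : 0 < c₀) (hA : 0 < A)
    (ht : 0 < t) (hle : c₀ * ν / A ^ 2 ≤ t) :
    ν ^ (1 / 2 : ℝ) * t ^ (-(1 / 2 : ℝ)) ≤ A / Real.sqrt c₀ := by
  have h1 : ν ^ (1 / 2 : ℝ) * t ^ (-(1 / 2 : ℝ)) = Real.sqrt (ν / t) := by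
    rw [Real.sqrt_eq_rpow, Real.div_rpow hν.le ht.le, Real.rpow_neg ht.le, ← div_eq_mul_inv]
  have h2 : A / Real.sqrt c₀ = Real.sqrt (A ^ 2 / c₀) := by
    rw [Real.sqrt_div (sq_nonneg A), Real.sqrt_sq hA.le]
  rw [h1, h2]
  refine Real.sqrt_le_sqrt ?_
  rw [div_le_div_iff₀ ht hc₀]
  have h3 : c₀ * ν ≤ t * A ^ 2 := by
    have := (div_le_iff₀ (by positivity : (0 : ℝ) < A ^ 2)).1 hle
    linarith
  linarith

end SmallL3ClassicalSupBound

open SmallL3ClassicalSupBound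

/-! ### The theorem -/

/-- **Small `L³` data generate, on every slab, a classical free run never exceeding twice the initial
maximum speed** (Kato 1984, Thm. 2–4, with Leray 1934, §19 (3.8)/§21 (3.15)). There is a universal
`c > 0` such that: for every viscosity `ν > 0`, every `T > 0`, every smooth compactly supported
divergence-free datum `u₀ : ℝ³ → ℝ³` with `|u₀(x)| ≤ A` for all `x` (`A > 0`) and `‖u₀‖_{L³} ≤ c ν`,
there is a classical solution `(u, p)` of the unforced Navier–Stokes system on `[0, T] × ℝ³` with
`u(0) = u₀`, in Tao's class (`HasBoundedSobolevNormsOn`, `L²`-continuous), of finite energy, with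
`|u(t, x)| ≤ 2A` for every `t ∈ [0, T]` and every `x`. (Short times `t < c₀ν/A²`: Leray's bound
`exists_norm_le_two_mul_of_finiteEnergy`; long times: Kato's decay `K(‖u₀‖₃/ν)ν^{1/2}t^{-1/2} ≤ KcA/√c₀ ≤ A`.)
[cite: Kato1984, Thm. 2–4] [cite: Leray1934, §19 (3.8) p. 223 and §21 (3.15) p. 226]
[cite: LemarieRieusset2016, Thm. 15.2 with Thm. 7.2/7.3] -/
theorem exists_classical_run_norm_le_two_mul :
    ∃ c : ℝ, 0 < c ∧ ∀ ⦃ν T A : ℝ⦄ ⦃u₀ : EuclideanSpace ℝ (Fin 3) → EuclideanSpace ℝ (Fin 3)⦄,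
      0 < ν → 0 < T → ContDiff ℝ ∞ u₀ → HasCompactSupport u₀ → VectorCalculus.IsDivFree u₀ →
      0 < A → (∀ x, ‖u₀ x‖ ≤ A) → (eLpNorm u₀ 3 volume).toReal ≤ c * ν →
      ∃ (u : ℝ → EuclideanSpace ℝ (Fin 3) → EuclideanSpace ℝ (Fin 3))
        (p : ℝ → EuclideanSpace ℝ (Fin 3) → ℝ),
        IsClassicalNSSolutionOn (Icc 0 T) ν 0 u p ∧ u 0 = u₀ ∧
        HasBoundedSobolevNormsOn (Icc 0 T) u ∧ ContinuousInLpOn (Icc 0 T) 2 u ∧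
        (∃ C : ℝ≥0∞, C < ⊤ ∧ ∀ t ∈ Icc 0 T, ∫⁻ x, ‖u t x‖ₑ ^ 2 ≤ C) ∧
        ∀ t ∈ Icc 0 T, ∀ x, ‖u t x‖ ≤ 2 * A := by
  obtain ⟨ε₀, K, hε₀, hK, hAK⟩ := KatoAprioriForced.kato_apriori_forced
  obtain ⟨c₀, hc₀, hshort⟩ := exists_norm_le_two_mul_of_finiteEnergy
  set c : ℝ := min ε₀ (Real.sqrt c₀ / K) with hc
  have hcpos : 0 < c := lt_min hε₀ (div_pos (Real.sqrt_pos.2 hc₀) hK)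
  have hcε : c ≤ ε₀ := min_le_left _ _
  have hcK : K * c ≤ Real.sqrt c₀ := by
    have h1 : c ≤ Real.sqrt c₀ / K := min_le_right _ _
    rw [le_div_iff₀ hK] at h1
    linarith
  refine ⟨c, hcpos, ?_⟩
  intro ν T A u₀ hν hT hu₀ hu₀c hdiv hA hA0 hL3
  -- the dimensionless size `δ = ‖u₀‖₃ / ν ≤ c ≤ ε₀`
  set δ : ℝ := (eLpNorm u₀ 3 volume).toReal / ν with hδ
  have hδc : δ ≤ c := by rw [hδ, div_le_iff₀ hν]; exact hL3
  have hδ0 : 0 ≤ δ := by positivity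
  have hz : T ^ (3 / 4 : ℝ) * (4 * Real.sqrt 3 * 0) / ν ^ (5 / 4 : ℝ) = 0 := by simp
  have hsmall : (eLpNorm u₀ 3 volume).toReal / ν +
      T ^ (3 / 4 : ℝ) * (4 * Real.sqrt 3 * 0) / ν ^ (5 / 4 : ℝ) ≤ ε₀ := by
    rw [hz, add_zero]; exact hδc.trans hcε
  have hf2 : ∀ t ∈ Icc 0 T,
      eLpNorm ((0 : ℝ → EuclideanSpace ℝ (Fin 3) → EuclideanSpace ℝ (Fin 3)) t) 2 volume ≤
        ENNReal.ofReal 0 := fun t _ => eLpNorm_zero_slice_le t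
  -- Kato's classical solution on the full slab
  obtain ⟨u, p, hsol, h0, hub, hc2⟩ := KatoSmallDataForced.exists_classical_fullSlab hν hK.le hAK hT
    hu₀ hu₀c hdiv isSmoothOnHalfSpace_zero hasRapidSpaceTimeDecay_zero le_rfl hf2 hsmall
  -- finite energy from the order-`0` Sobolev bound
  have hE : ∃ C : ℝ≥0∞, C < ⊤ ∧ ∀ t ∈ Icc 0 T, ∫⁻ x, ‖u t x‖ₑ ^ 2 ≤ C := by
    obtain ⟨C₀, hC₀⟩ := hub 0
    refine ⟨C₀, ENNReal.coe_lt_top, fun t ht => ?_⟩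
    rw [← lintegral_iteratedFDeriv_zero_eq]
    exact hC₀ t ht
  refine ⟨u, p, hsol, h0, hub, hc2, hE, fun t ht x => ?_⟩
  by_cases htc : t < c₀ * ν / A ^ 2
  · -- short times: Leray's bound
    exact hshort hν hT hsol hE hA (fun y => by rw [h0]; exact hA0 y) t ht htc x
  · -- long times: Kato's decay
    rw [not_lt] at htc
    have ht0 : 0 < t := lt_of_lt_of_le (by positivity) htc
    have hkato := KatoSmallDataForced.norm_le_of_taoClass hν hAK hT hsol hub hc2 isSmoothOnHalfSpace_zero
      hasRapidSpaceTimeDecay_zero le_rfl hf2 (by rwa [h0]) ⟨ht0, ht.2⟩ x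
    rw [h0, hz, add_zero] at hkato
    have hrt : ν ^ (1 / 2 : ℝ) * t ^ (-(1 / 2 : ℝ)) ≤ A / Real.sqrt c₀ :=
      rpow_half_mul_rpow_neg_half_le hν hc₀ hA ht0 htc
    have hsc : 0 < Real.sqrt c₀ := Real.sqrt_pos.2 hc₀
    calc ‖u t x‖ ≤ K * δ * ν ^ (1 / 2 : ℝ) * t ^ (-(1 / 2 : ℝ)) := hkato
      _ = (K * δ) * (ν ^ (1 / 2 : ℝ) * t ^ (-(1 / 2 : ℝ))) := by ring
      _ ≤ (K * c) * (A / Real.sqrt c₀) :=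
          mul_le_mul (mul_le_mul_of_nonneg_left hδc hK.le) hrt (by positivity) (by positivity)
      _ ≤ Real.sqrt c₀ * (A / Real.sqrt c₀) := mul_le_mul_of_nonneg_right hcK (by positivity)
      _ = A := by field_simp
      _ ≤ 2 * A := by linarith

/-- **The same on a slab `[t₀, t₁]`** (`t₀ < t₁`; the system is autonomous): for a smooth compactly
supported divergence-free datum `u₀` with `|u₀| ≤ A` (`A > 0`) and `‖u₀‖_{L³} ≤ c ν` there is a classical
finite-energy free run `(u, p)` on `[t₀, t₁] × ℝ³` with `u(t₀) = u₀` and `|u(t, x)| ≤ 2A` throughout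
(time shift `IsClassicalNSSolutionOn.comp_add_right` of `exists_classical_run_norm_le_two_mul`).
[cite: Kato1984, Thm. 2–4] [cite: Leray1934, §19 (3.8) p. 223 and §21 (3.15) p. 226] -/
theorem exists_classical_run_norm_le_two_mul_Icc :
    ∃ c : ℝ, 0 < c ∧ ∀ ⦃ν t₀ t₁ A : ℝ⦄ ⦃u₀ : EuclideanSpace ℝ (Fin 3) → EuclideanSpace ℝ (Fin 3)⦄,
      0 < ν → t₀ < t₁ → ContDiff ℝ ∞ u₀ → HasCompactSupport u₀ → VectorCalculus.IsDivFree u₀ →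
      0 < A → (∀ x, ‖u₀ x‖ ≤ A) → (eLpNorm u₀ 3 volume).toReal ≤ c * ν →
      ∃ (u : ℝ → EuclideanSpace ℝ (Fin 3) → EuclideanSpace ℝ (Fin 3))
        (p : ℝ → EuclideanSpace ℝ (Fin 3) → ℝ),
        IsClassicalNSSolutionOn (Icc t₀ t₁) ν 0 u p ∧ u t₀ = u₀ ∧
        (∃ C : ℝ≥0∞, C < ⊤ ∧ ∀ t ∈ Icc t₀ t₁, ∫⁻ x, ‖u t x‖ₑ ^ 2 ≤ C) ∧
        ∀ t ∈ Icc t₀ t₁, ∀ x, ‖u t x‖ ≤ 2 * A := by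
  obtain ⟨c, hc, hrun⟩ := exists_classical_run_norm_le_two_mul
  refine ⟨c, hc, ?_⟩
  intro ν t₀ t₁ A u₀ hν ht₀₁ hu₀ hu₀c hdiv hA hA0 hL3
  set W : ℝ := t₁ - t₀ with hWdef
  have hW : 0 < W := by rw [hWdef]; linarith
  obtain ⟨u, p, hsol, h0, -, -, hE, hbd⟩ := hrun hν hW hu₀ hu₀c hdiv hA hA0 hL3
  -- shift `[0, W]` to `[t₀, t₁]`
  have hshift := hsol.comp_add_right (-t₀)
  have hset : ((· + -t₀) ⁻¹' Icc 0 W : Set ℝ) = Icc t₀ t₁ := by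
    ext t
    simp only [mem_preimage, mem_Icc, hWdef]
    constructor <;> intro h <;> constructor <;> linarith [h.1, h.2]
  have hforce : (fun t => (0 : ℝ → EuclideanSpace ℝ (Fin 3) → EuclideanSpace ℝ (Fin 3)) (t + -t₀)) =
      (0 : ℝ → EuclideanSpace ℝ (Fin 3) → EuclideanSpace ℝ (Fin 3)) := by
    funext t; rfl
  rw [hset, hforce] at hshift
  have hmem : ∀ t ∈ Icc t₀ t₁, t + -t₀ ∈ Icc 0 W := fun t ht => by
    rw [hWdef]; exact ⟨by linarith [ht.1], by linarith [ht.2]⟩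
  refine ⟨fun t => u (t + -t₀), fun t => p (t + -t₀), hshift, ?_, ?_, fun t ht x => hbd _ (hmem t ht) x⟩
  · show u (t₀ + -t₀) = u₀
    rw [add_neg_cancel, h0]
  · obtain ⟨C, hC, hb⟩ := hE
    exact ⟨C, hC, fun t ht => hb _ (hmem t ht)⟩

end Literature.Analysis.FluidPDE

end
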